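import Summits.QuantumFields.BalabanUV.T4Continuum.Support.ShellMeasureWilsonRealizedSU2
import Summits.QuantumFields.BalabanUV.T4Continuum.Support.ShellMeasureHeadlines
import Summits.QuantumFields.BalabanUV.T4Continuum.Support.ShellMeasureAxialReach

/-!
# `T4Continuum.ShellMeasureWilsonGaugeInvariant` — (M1)₀ REALIZED for `G = SU(2)` with a GAUGE-INVARIANT density:
# interior plaquette CO-TESTS instead of the bond window, the window being IMPLIED after the tree gauge ((LR)₀)
# (cell `pub-balaban`, sub-cell `t4`, spine estimate NE7c (node U5b); lineage t4-ne7c-p1 = PROVER seat P1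
# «shell-measure route», generation 26; seat S1 of the ROUND-2 skeleton `t4/skeletons/NE7c-t4-ne7c-p1.md` executed;
# ADDITIVE — imports `ShellMeasureWilsonRealizedSU2` (p206694), `ShellMeasureHeadlines` (p203109) and the companion
# `ShellMeasureAxialReach` (this generation) only)

HONEST FRAMING.  Finite four-torus programme, rung (B)+1 only — NOT infinite volume, NOT a mass gap, NOT the Clay
problem, NOT summit progress; (B), `BetaPertHyp`, (B^μ) not consumed.  (M1) for BAŁABAN'S INDUCTIVELY DEFINED
EFFECTIVE MEASURES is NOT PRINTED (GAPS G-ne7cp1-1), asserted by nobody, and NOT moved here: this is the LEVEL-0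
instance again (bare Wilson step; level 0 is in NE7c's live window only for `K ≤ N₁`).  What changes with respect to
`ShellMeasureWilsonRealizedSU2.slotAntiConcentration_wilson_su2`: there the small-field window sat on the block's BOND
variables inside the weight («(LR)₀ assumed as the window»); here the density is GAUGE INVARIANT — the Wilson weight of
B12 (0.2) over any finite plaquette set `P_w` times the INTERIOR PLAQUETTE CO-TEST `1[dist1 U(∂p) < σ, p ⊂ box]` of a
non-wrapping box (B14 (2.17) at `k = 0` reads plaquette variables, never bond variables) — and the bond window is
DERIVED: transport through the tree gauge on the axial comb (`ShellMeasureHeadlines.slotAntiConcentration_realized_su2_gaugeInvariant`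
with `T4TreeGaugeFixing.noClosedLoop_combBonds`), then the reach lemma `ShellMeasureAxialReach.expWindowDensity_eq_one_of_comb`
(plaquette-small + comb-trivial ⟹ every box bond in `expWindow 1 S`).  The co-test indicator rides as a centre-monotone
factor: by the level-0 core map at threshold `σ` (`ShellMeasureWilsonWords.coreMap_word`, smallness (SM)_σ) a `σ`-small
box plaquette stays `σ`-small along the contraction; the comb bonds enter the plaquette words as FROZEN UNIT LETTERS
(`exists_gens_of_frozen_eq_one`).  STILL OPEN AT LEVEL 0: (MR)₀ only — co-tests STRADDLING the box are absent from the
density (neither centre-monotone nor blind to the block; successor task (0-c), small-field dominance).  0 sorry,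
0 citations; the series enters only through the DEFINITIONS `Setup.plaqHol`, `reTr`, `dist1` (B12 (0.2), B7 (19)).
HONEST DEPENDENCY (cell): continuum YM on T⁴ ⇐ BetaPertH ∧ nine spine estimates (0/9 proved); BetaPertH ⇐ (D1) ∧ (D4) ∧
CAP+tail; G-an2-4 gates asym, D1 and NE2/3/4.

THE THEOREM (`slotAntiConcentration_wilson_su2_gaugeInvariant`).  Lattice `T^{(j)}` of the cell, `G = SU(2)`; a
NON-WRAPPING box `[lo, hi]` (`hi − lo < sitesPerDir` coordinatewise, `hi ≤ lo + m`); chart bonds `Λ` = the box bonds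
off the axial comb (`Λ ⊆ boxBonds`, `Λ ∩ combBonds = ∅`, `boxBonds ⊆ Λ ∪ combBonds`) with an enumeration `e` of the
`n = 3·#Λ` coordinates; window half-side `0 < S ≤ 1/8`; co-test threshold `σ > 0` with the REACH CONDITION
`(d − 1)·m·σ ≤ 2S/π`; classifier plaquettes `∅ ≠ P_u ⊆ boxPlaqs`; weight plaquettes `P_w` (any); `β ≥ 0`; `θ > 0`,
`0 ≤ δ < 1`, `0 ≤ ρ ≤ (1−δ)/2`; (SM)₀ `4(8S)²e^{16S} ≤ δθ` and (SM)_σ `4(8S)²e^{16S} ≤ δσ` (jointly satisfiable: for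
`θ, σ ≲ S/((d−1)m)` take `S ≲ δ/((d−1)m)`).  DENSITY `giF = 1[∀ p ∈ boxPlaqs, dist1 U(∂p) < σ]·exp(−β Σ_{p∈P_w}(1 − reTr U(∂p)))`,
CLASSIFIER `wilsonU = max_{p∈P_u} dist1 U(∂p)` (both gauge invariant).  CONCLUSION:
`SlotAntiConcentration ((fieldMeasure P j SU2).withDensity giF) wilsonU θ ρ (2·(n + β·#P_w·8S·(8 + 32S))/(1−δ))`.
WHAT THIS DOES NOT DO.  (MR)₀; anything at `j ≥ 1` (there the tested variables are plaquette functionals of the localized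
MINIMISER; inputs = the located binders of `ShellMeasureLevelAssembly`, G-ne7cp1-26); NE7c NOT proved; 0/9 spine.
-/

noncomputable section

open NormedSpace Set Function MeasureTheory

namespace Summit.QuantumFields.BalabanUV.T4Continuum.ShellMeasureWilsonGaugeInvariant

open scoped ENNReal Matrix.Norms.L2Operator
open Literature.MathematicalPhysics.QuantumFieldTheory.Balaban1983to89
open GaugeField (GaugeInvariant)
open T4ShellMeasure (SlotAntiConcentration)
open T4CubePoincare (cube)
open T4CubeChartGnomonic (SU2)
open T4CubeChartExp (expFibreChart expWindowDensity expWindowDensity_congr)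
open T4ShellMeasureDet (blockLaw)
open T4TreeGaugeFixing (fixTo fixTo_apply_of_mem fixTo_apply_of_not_mem measurable_fixTo noClosedLoop_combBonds)
open T4AxialGaugeFixing (combBonds mem_combBonds)
open T4AxialGaugeSmallField (castSite castSite_add_e boxPlaqs boxBonds)
open B7Prop1Explicit (e)
open B8Lemma1NonAbelian (e_nonneg)
open ShellMeasureWilsonWords (scale normSum wordExp coreMap_sup coreMap_word interpConst_mono depth_admissible
  normSum_nonneg scale_one)
open ShellMeasureWilsonTrace (Letter wordEval sGen dFro TraceData)
open ShellMeasureWilsonBlock (matrixTrace wilsonAction_contract_sub_le wilson_dictionary_specialUnitaryGroup)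
open ShellMeasureWilsonRealizedSU2 (M₂ letter plaqWord coe_plaqHol_eq_wordEval wordEval_plaqWord_smul plaqWord_data
  wilsonU measurable_wilsonU measurable_wilsonSum wilsonSum_nonneg wilsonSum_chart_smul)
open ShellMeasureHeadlines (fixTo_updateFinset_of_disjoint slotAntiConcentration_realized_su2_gaugeInvariant)
open ShellMeasureAxialReach (fixTo_comb_eq_one expWindowDensity_eq_one_of_comb)

/-! ## §1 Words with unit frozen letters are words of exponentials of their generators -/

section Words

variable {A : Type*} [NormedRing A] [NormedAlgebra ℂ A]

/-- **UNIT FROZEN LETTERS DROP OUT.**  A sectioned word all of whose frozen letters equal `1` evaluates, at every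
contraction parameter `c`, to the word of exponentials of its SCALED generators (in order), whose total size is the
word's generator size `s(w)` — so the level-0 core map `ShellMeasureWilsonWords.coreMap_word` applies to it.  (The comb
bonds of the tree gauge are such letters.) [folklore] -/
theorem exists_gens_of_frozen_eq_one : ∀ (w : List (Letter A)), (∀ a, Letter.frozen a ∈ w → a = 1) →
    ∃ l : List A, normSum l = sGen w ∧ ∀ c : ℝ, wordEval c w = wordExp (scale c l)
  | [], _ => ⟨[], by simp, fun c => by simp⟩
  | Letter.frozen a :: w, h => by
    obtain ⟨l, hl, hlc⟩ := exists_gens_of_frozen_eq_one w fun a' ha' => h a' (List.mem_cons_of_mem _ ha')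
    have ha : a = 1 := h a (by simp)
    refine ⟨l, ?_, fun c => ?_⟩
    · rw [ShellMeasureWilsonTrace.sGen_cons, hl]
      simp [Letter.genNorm]
    · rw [ShellMeasureWilsonTrace.wordEval_cons, hlc c, Letter.eval_frozen, ha, one_mul]
  | Letter.gen Y :: w, h => by
    obtain ⟨l, hl, hlc⟩ := exists_gens_of_frozen_eq_one w fun a' ha' => h a' (List.mem_cons_of_mem _ ha')
    refine ⟨Y :: l, ?_, fun c => ?_⟩
    · rw [ShellMeasureWilsonWords.normSum_cons, ShellMeasureWilsonTrace.sGen_cons, hl]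
      simp [Letter.genNorm]
    · rw [ShellMeasureWilsonTrace.wordEval_cons, hlc c, Letter.eval_gen, ShellMeasureWilsonWords.scale_cons,
        ShellMeasureWilsonWords.wordExp_cons]

end Words

/-! ## §2 Box geometry: the bonds of a box plaquette; comb bonds are unit frozen letters -/

section Geometry

variable {P : Params} {j : ℕ}

/-- the four bonds of a box plaquette are box bonds. [folklore] -/
theorem bonds_mem_boxBonds {lo hi : Fin P.d → ℤ} {p : Plaq P j} (hp : p ∈ boxPlaqs lo hi) :
    (⟨p.src, p.μ⟩ : PBond P j) ∈ boxBonds lo hi ∧ (⟨p.src.shift p.μ, p.ν⟩ : PBond P j) ∈ boxBonds lo hi ∧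
      (⟨p.src.shift p.ν, p.μ⟩ : PBond P j) ∈ boxBonds lo hi ∧ (⟨p.src, p.ν⟩ : PBond P j) ∈ boxBonds lo hi := by
  obtain ⟨z, hlo, hhi, hsrc⟩ := hp
  have hμ := e_nonneg (d := P.d) p.μ
  have hν := e_nonneg (d := P.d) p.ν
  refine ⟨⟨z, hlo, (le_add_of_nonneg_right hν).trans hhi, hsrc⟩,
    ⟨z + e p.μ, hlo.trans (le_add_of_nonneg_right hμ), hhi, by rw [hsrc, castSite_add_e]⟩,
    ⟨z + e p.ν, hlo.trans (le_add_of_nonneg_right hν), by rw [add_right_comm]; exact hhi,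
      by rw [hsrc, castSite_add_e]⟩,
    ⟨z, hlo, le_trans (by rw [add_right_comm]; exact le_add_of_nonneg_right hμ) hhi, hsrc⟩⟩

variable [DecidableEq (PBond P j)] (Λ : Finset (PBond P j)) {n : ℕ} (e : ↥Λ × Fin 3 ≃ Fin n)

/-- an exterior bond carrying the value `1` is the frozen UNIT letter, in both orientations. [folklore] -/
theorem letter_frozen_eq_one {W : GaugeField P j SU2} {x : Fin n → ℝ} {b : PBond P j} {inv : Bool} {a : M₂}
    (h : letter Λ e W x b inv = Letter.frozen a) (hW : b ∉ Λ → W b = 1) : a = 1 := by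
  unfold letter at h
  by_cases hb : b ∈ Λ
  · rw [dif_pos hb] at h
    exact absurd h (by simp)
  · rw [dif_neg hb, hW hb] at h
    cases inv <;> simp at h <;> exact h.symm

/-- **COMB BONDS ARE UNIT FROZEN LETTERS**: for a box plaquette `p`, if every bond of the box off `Λ` carries the
value `1` in `W` (the tree-gauged exterior `W = V[comb := 1]` with `boxBonds ⊆ Λ ∪ comb`), then every frozen letter
of the sectioned plaquette word `plaqWord Λ e W x p` equals `1`. [folklore] -/
theorem frozen_eq_one_of_mem_plaqWord {lo hi : Fin P.d → ℤ} {W : GaugeField P j SU2}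
    (hW : ∀ b ∈ boxBonds lo hi, b ∉ Λ → W b = 1) (x : Fin n → ℝ) {p : Plaq P j} (hp : p ∈ boxPlaqs lo hi) :
    ∀ a, Letter.frozen a ∈ plaqWord Λ e W x p → a = 1 := by
  obtain ⟨h1, h2, h3, h4⟩ := bonds_mem_boxBonds hp
  intro a ha
  unfold plaqWord at ha
  simp only [List.mem_cons, List.not_mem_nil, or_false] at ha
  rcases ha with h | h | h | h
  · exact letter_frozen_eq_one Λ e h.symm (hW _ h1)
  · exact letter_frozen_eq_one Λ e h.symm (hW _ h2)
  · exact letter_frozen_eq_one Λ e h.symm (hW _ h3)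
  · exact letter_frozen_eq_one Λ e h.symm (hW _ h4)

end Geometry

/-! ## §3 The gauge-invariant realized objects -/

section Objects

variable {P : Params} {j : ℕ} (lo hi : Fin P.d → ℤ)

/-- THE INTERIOR PLAQUETTE CO-TEST of the box: all box plaquettes `σ`-small (`Setup.PlaqSmallOn`, B14 (2.17) at
`k = 0` restricted to the plaquettes of the box). [folklore] -/
def boxTest (σ : ℝ) : Set (GaugeField P j SU2) := {U | PlaqSmallOn (boxPlaqs lo hi) σ U}

/-- THE GAUGE-INVARIANT REALIZED DENSITY: co-test indicator times the Wilson weight of B12 (0.2) over `P_w`.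
[folklore] -/
def giF (σ β : ℝ) (Pw : Finset (Plaq P j)) (U : GaugeField P j SU2) : ℝ≥0∞ :=
  (boxTest lo hi σ).indicator 1 U *
    ENNReal.ofReal (Real.exp (-(β * ∑ p ∈ Pw, (1 - reTr (GaugeField.plaqHol U p)))))

variable {lo hi}

/-- membership in the co-test, unfolded. [folklore] -/
theorem mem_boxTest_iff {σ : ℝ} {U : GaugeField P j SU2} :
    U ∈ boxTest lo hi σ ↔ ∀ p ∈ boxPlaqs lo hi, dist1 (GaugeField.plaqHol U p) < σ := Iff.rfl

variable (lo hi)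

/-- the co-test event is measurable. [folklore] -/
theorem measurableSet_boxTest (σ : ℝ) : MeasurableSet (boxTest lo hi σ : Set (GaugeField P j SU2)) := by
  have h : (boxTest lo hi σ : Set (GaugeField P j SU2)) =
      ⋂ p ∈ boxPlaqs lo hi, {U | dist1 (GaugeField.plaqHol U p) < σ} := by
    ext U
    simp only [mem_boxTest_iff, mem_iInter, mem_setOf_eq]
  rw [h]
  exact MeasurableSet.biInter (Set.to_countable _) fun p _ =>
    measurableSet_lt (RegularGaugeGroup.measurable_dist1.comp (Missing.measurable_plaqHol p)) measurable_const

/-- `giF` is measurable. [folklore] -/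
theorem measurable_giF (σ β : ℝ) (Pw : Finset (Plaq P j)) : Measurable (giF lo hi σ β Pw) := by
  unfold giF
  refine (measurable_one.indicator (measurableSet_boxTest lo hi σ)).mul ?_
  exact ENNReal.measurable_ofReal.comp (Real.measurable_exp.comp ((measurable_const.mul (measurable_wilsonSum Pw))).neg)

/-- `giF ≤ 1` (`β ≥ 0`). [folklore] -/
theorem giF_le_one {σ β : ℝ} (hβ : 0 ≤ β) (Pw : Finset (Plaq P j)) (U : GaugeField P j SU2) :
    giF lo hi σ β Pw U ≤ 1 := by
  unfold giF
  have h1 : (boxTest lo hi σ).indicator (1 : GaugeField P j SU2 → ℝ≥0∞) U ≤ 1 :=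
    indicator_apply_le' (fun _ => le_rfl) (fun _ => zero_le_one)
  have h2 : ENNReal.ofReal (Real.exp (-(β * ∑ p ∈ Pw, (1 - reTr (GaugeField.plaqHol U p))))) ≤ 1 := by
    rw [ENNReal.ofReal_le_one, Real.exp_le_one_iff, neg_nonpos]
    exact mul_nonneg hβ (wilsonSum_nonneg Pw U)
  calc _ ≤ (1 : ℝ≥0∞) * 1 := mul_le_mul' h1 h2
    _ = 1 := one_mul _

/-- the co-test is gauge invariant (plaquette variables are conjugated, `dist1` is a class function). [folklore] -/
theorem boxTest_gaugeAct_iff (σ : ℝ) (g : GaugeTransf P j SU2) (U : GaugeField P j SU2) :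
    GaugeField.gaugeAct g U ∈ boxTest lo hi σ ↔ U ∈ boxTest lo hi σ := by
  simp only [mem_boxTest_iff, T4ReTrLipUnitary.plaqHol_gaugeAct, GaugeGroup.dist1_conj]

/-- the Wilson energy over `P_w` is gauge invariant (`reTr` is a class function). [folklore] -/
theorem wilsonSum_gaugeAct (Pw : Finset (Plaq P j)) (g : GaugeTransf P j SU2) (U : GaugeField P j SU2) :
    ∑ p ∈ Pw, (1 - reTr (GaugeField.plaqHol (GaugeField.gaugeAct g U) p)) =
      ∑ p ∈ Pw, (1 - reTr (GaugeField.plaqHol U p)) :=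
  Finset.sum_congr rfl fun p _ => by rw [T4ReTrLipUnitary.plaqHol_gaugeAct, GaugeGroup.reTr_conj]

/-- **THE DENSITY IS GAUGE INVARIANT**. [folklore] -/
theorem gaugeInvariant_giF (σ β : ℝ) (Pw : Finset (Plaq P j)) : GaugeInvariant (giF lo hi σ β Pw) := by
  intro g U
  by_cases hU : U ∈ boxTest lo hi σ
  · have hgU : GaugeField.gaugeAct g U ∈ boxTest lo hi σ := (boxTest_gaugeAct_iff lo hi σ g U).2 hU
    unfold giF
    rw [indicator_of_mem hU, indicator_of_mem hgU, wilsonSum_gaugeAct]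
    simp only [Pi.one_apply]
  · have hgU : GaugeField.gaugeAct g U ∉ boxTest lo hi σ := mt (boxTest_gaugeAct_iff lo hi σ g U).1 hU
    unfold giF
    rw [indicator_of_notMem hU, indicator_of_notMem hgU, zero_mul, zero_mul]

/-- **THE CLASSIFIER IS GAUGE INVARIANT**. [folklore] -/
theorem gaugeInvariant_wilsonU {Pu : Finset (Plaq P j)} (hPu : Pu.Nonempty) :
    GaugeInvariant (wilsonU hPu (P := P) (j := j)) := by
  intro g U
  unfold wilsonU
  exact Finset.sup'_congr hPu rfl fun p _ => by rw [T4ReTrLipUnitary.plaqHol_gaugeAct, GaugeGroup.dist1_conj]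

/-- a density bounded by `1` has finite total mass against a finite measure. [folklore] -/
theorem withDensity_univ_ne_top_of_le_one {α : Type*} [MeasurableSpace α] (μ : Measure α) [IsFiniteMeasure μ]
    {f : α → ℝ≥0∞} (hf : ∀ x, f x ≤ 1) : (μ.withDensity f) univ ≠ ∞ := by
  rw [withDensity_apply _ MeasurableSet.univ, Measure.restrict_univ]
  exact ne_top_of_le_ne_top (measure_ne_top μ univ) ((lintegral_mono hf).trans_eq lintegral_one)

end Objects

/-! ## §4 (M1)₀ realized, gauge-invariant form -/

section Main

variable {P : Params} {j : ℕ} [DecidableEq (PBond P j)]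

/-- **(M1)₀ REALIZED FOR `G = SU(2)`, GAUGE-INVARIANT DENSITY, NO BOND WINDOW** — see the module docstring.
[folklore] -/
theorem slotAntiConcentration_wilson_su2_gaugeInvariant
    {lo hi : Fin P.d → ℤ} {m : ℕ} (hN : ∀ κ, hi κ - lo κ < P.sitesPerDir j) (hm : ∀ κ, hi κ ≤ lo κ + m)
    (Λ : Finset (PBond P j)) (hΛbox : ∀ b ∈ Λ, b ∈ boxBonds lo hi)
    (hΛcomb : Disjoint Λ (combBonds lo hi))
    (hcov : ∀ b ∈ boxBonds lo hi, b ∉ Λ → b ∈ (combBonds lo hi : Finset (PBond P j)))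
    {n : ℕ} (e : ↥Λ × Fin 3 ≃ Fin n)
    {S σ : ℝ} (hS : 0 < S) (hS8 : S ≤ 1 / 8) (hSπ : 3 * S ^ 2 < Real.pi ^ 2) (hσ : 0 < σ)
    (hrad : ((P.d - 1 : ℕ) : ℝ) * m * σ ≤ 2 * S / Real.pi)
    {Pu : Finset (Plaq P j)} (hPu : Pu.Nonempty) (hPubox : ∀ p ∈ Pu, p ∈ boxPlaqs lo hi)
    (Pw : Finset (Plaq P j)) {β θ δ ρ : ℝ} (hβ : 0 ≤ β) (hθ : 0 < θ) (hδ0 : 0 ≤ δ) (hδ1 : δ < 1) (hρ0 : 0 ≤ ρ)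
    (hρ : ρ ≤ (1 - δ) / 2) (hSM : 4 * (8 * S) ^ 2 * Real.exp (2 * (8 * S)) ≤ δ * θ)
    (hSMσ : 4 * (8 * S) ^ 2 * Real.exp (2 * (8 * S)) ≤ δ * σ) :
    SlotAntiConcentration ((fieldMeasure P j SU2).withDensity (giF lo hi σ β Pw)) (wilsonU hPu) θ ρ
      (2 * ((n : ℝ) + β * ∑ _p ∈ Pw, (8 * S) * (8 + 4 * (8 * S))) / (1 - δ)) := by
  -- the depth (as in `ShellMeasureWilsonRealizedSU2.slotAntiConcentration_wilson_su2`)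
  have h1δ : 0 < 1 - δ := by linarith
  set ρ' := ρ / (1 - δ) with hρ'
  have hρ'0 : 0 ≤ ρ' := div_nonneg hρ0 h1δ.le
  have hρ'2 : ρ' ≤ 1 / 2 := by rw [hρ', div_le_iff₀ h1δ]; linarith
  set a := -Real.log (1 - ρ') with ha
  have hc0 : 0 < 1 - ρ' := by linarith
  have hc1 : 1 - ρ' ≤ 1 := by linarith
  have hexp : Real.exp (-a) = 1 - ρ' := by rw [ha, neg_neg, Real.exp_log hc0]
  have ha0 : 0 ≤ a := by rw [ha, neg_nonneg]; exact Real.log_nonpos hc0.le hc1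
  have ha2 : a ≤ 2 * ρ' := T4ShellMeasureFibre.neg_log_one_sub_le hρ'0 hρ'2
  have h1ca : 1 - (1 - ρ') ≤ a := by
    have h := Real.log_le_sub_one_of_pos hc0
    rw [ha]; linarith
  have hdepth : (1 - ρ') * (1 + δ * (1 - (1 - ρ'))) ≤ 1 - ρ := by rw [hρ']; exact depth_admissible hδ0 hδ1 hρ0
  have hdepth0 : (1 - ρ') * (1 + δ * (1 - (1 - ρ'))) ≤ 1 - 0 := by linarith
  set Bf := β * ∑ _p ∈ Pw, (8 * S) * (8 + 4 * (8 * S)) with hBf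
  have hBf0 : 0 ≤ Bf := by rw [hBf]; exact mul_nonneg hβ (Finset.sum_nonneg fun p _ => by positivity)
  have hNtr : 0 < (matrixTrace (n := Fin 2)).N := ShellMeasureWilsonBlock.matrixTrace_N_pos
  have h8S1 : 8 * S ≤ 1 := by linarith
  -- the tree: the axial comb of the non-wrapping box is loop-free
  have hT := noClosedLoop_combBonds (P := P) (j := j) hN
  -- the tree-gauged exterior carries unit letters on the comb
  have hWcomb : ∀ (V : GaugeField P j SU2), ∀ b ∈ boxBonds lo hi, b ∉ Λ →
      fixTo (combBonds lo hi) 1 V b = 1 :=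
    fun V b hb hbΛ => fixTo_comb_eq_one lo hi V b (hcov b hb hbΛ)
  -- generator lists of the box plaquette words (comb letters drop out)
  have hgen : ∀ (V : GaugeField P j SU2) (x : Fin n → ℝ) (p : Plaq P j), p ∈ boxPlaqs lo hi →
      ∃ l : List M₂, normSum l = sGen (plaqWord Λ e (fixTo (combBonds lo hi) 1 V) x p) ∧
        ∀ c : ℝ, wordEval c (plaqWord Λ e (fixTo (combBonds lo hi) 1 V) x p) = wordExp (scale c l) :=
    fun V x p hp => exists_gens_of_frozen_eq_one _ (frozen_eq_one_of_mem_plaqWord Λ e (hWcomb V) x hp)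
  choose! L hLnorm hLeval using hgen
  -- DICTIONARY: the plaquette variable of the tree-gauged section at the chart point `c • x` is the scaled word
  have hD1 : ∀ (V : GaugeField P j SU2) (x : Fin n → ℝ) (p : Plaq P j), p ∈ boxPlaqs lo hi → ∀ c : ℝ,
      dist1 (GaugeField.plaqHol (fixTo (combBonds lo hi) 1
        (updateFinset V Λ (expFibreChart Λ 1 e (c • x)))) p) = ‖wordExp (scale c (L V x p)) - 1‖ := by
    intro V x p hp c
    rw [fixTo_updateFinset_of_disjoint hΛcomb, ← (wilson_dictionary_specialUnitaryGroup _).2,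
      coe_plaqHol_eq_wordEval, wordEval_plaqWord_smul, hLeval V x p hp c]
  have hD1one : ∀ (V : GaugeField P j SU2) (x : Fin n → ℝ) (p : Plaq P j), p ∈ boxPlaqs lo hi →
      dist1 (GaugeField.plaqHol (fixTo (combBonds lo hi) 1
        (updateFinset V Λ (expFibreChart Λ 1 e x))) p) = ‖wordExp (L V x p) - 1‖ := by
    intro V x p hp
    have h := hD1 V x p hp 1
    rwa [one_smul, scale_one] at h
  -- sizes on the cube: `normSum (L V x p) ≤ 8S ≤ 1`
  have hLsize : ∀ (V : GaugeField P j SU2) (x : Fin n → ℝ), x ∈ cube n S → ∀ p ∈ boxPlaqs lo hi,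
      normSum (L V x p) ≤ 8 * S := by
    intro V x hx p hp
    rw [hLnorm V x p hp]
    exact (plaqWord_data Λ e hS.le (fixTo (combBonds lo hi) 1 V) hx p).2.1
  -- the classifier of the tree-gauged section, read in the chart
  have hU : ∀ (V : GaugeField P j SU2) (x : Fin n → ℝ) (c : ℝ),
      wilsonU hPu (fixTo (combBonds lo hi) 1 (updateFinset V Λ (expFibreChart Λ 1 e (c • x)))) =
        Pu.sup' hPu fun p => ‖wordExp (scale c (L V x p)) - 1‖ := by
    intro V x c
    unfold wilsonU
    exact Finset.sup'_congr hPu rfl fun p hp => hD1 V x p (hPubox p hp) c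
  -- the co-test survives the contraction (core map at threshold σ)
  have hmono : ∀ (V : GaugeField P j SU2) (x : Fin n → ℝ), x ∈ cube n S →
      fixTo (combBonds lo hi) 1 (updateFinset V Λ (expFibreChart Λ 1 e x)) ∈ boxTest lo hi σ →
      fixTo (combBonds lo hi) 1 (updateFinset V Λ (expFibreChart Λ 1 e ((1 - ρ') • x))) ∈ boxTest lo hi σ := by
    intro V x hx hmem p hp
    rw [hD1 V x p hp (1 - ρ')]
    have h1 : ‖wordExp (L V x p) - 1‖ < σ := by rw [← hD1one V x p hp]; exact hmem p hp
    have hs := hLsize V x hx p hp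
    have h := coreMap_word (L V x p) hc0 hc1 (hs.trans h8S1) hσ
      ((interpConst_mono (normSum_nonneg _) hs).trans hSMσ) hdepth0 h1
    simpa using h
  -- THE ENGINE, through the tree gauge
  refine slotAntiConcentration_realized_su2_gaugeInvariant hT 1 Λ e hS hSπ (fun _ => (1 : GaugeField P j SU2))
    (R := fun V y => giF lo hi σ β Pw (fixTo (combBonds lo hi) 1 (updateFinset V Λ y)))
    (fun V => (measurable_giF lo hi σ β Pw).comp ((measurable_fixTo _ 1).comp measurable_updateFinset))
    (measurable_giF lo hi σ β Pw) (gaugeInvariant_giF lo hi σ β Pw) (fun V y => ?_)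
    (fun V => withDensity_univ_ne_top_of_le_one (blockLaw Λ) fun y => giF_le_one lo hi hβ Pw _)
    (measurable_wilsonU hPu) (gaugeInvariant_wilsonU hPu) (a := a) (Bf := Bf) hθ.le hρ0 ha0 ?_ ?_ ?_
  · -- (LR)₀: the window factorisation is IMPLIED — on the support all box plaquettes are σ-small, the exterior is
    -- comb-trivial, so every chart bond lies in the window (`ShellMeasureAxialReach`)
    by_cases hmem : fixTo (combBonds lo hi) 1 (updateFinset V Λ y) ∈ boxTest lo hi σ
    · have hwin : expWindowDensity Λ 1 S (fixTo (combBonds lo hi) 1 (updateFinset V Λ y)) = 1 :=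
        expWindowDensity_eq_one_of_comb _ (S₀ := boxPlaqs lo hi) subset_rfl hmem hσ.le hm
          (fixTo_comb_eq_one lo hi _) hS.le hrad hΛbox
      have hcongr : expWindowDensity Λ 1 S (fixTo (combBonds lo hi) 1 (updateFinset V Λ y)) =
          expWindowDensity Λ (1 : GaugeField P j SU2) S (updateFinset (1 : GaugeField P j SU2) Λ y) :=
        expWindowDensity_congr fun b hb => by
          have hbT : b ∉ combBonds lo hi := Finset.disjoint_left.1 hΛcomb hb
          simp [fixTo, updateFinset, hb, hbT]
      rw [← hcongr, hwin, ENNReal.ofReal_one, one_mul]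
    · have h0 : giF lo hi σ β Pw (fixTo (combBonds lo hi) 1 (updateFinset V Λ y)) = 0 := by
        unfold giF; rw [indicator_of_notMem hmem, zero_mul]
      rw [h0, mul_zero]
  · -- the constant
    have hn : (0 : ℝ) ≤ n + Bf := by positivity
    calc ((n : ℝ) + Bf) * a ≤ (n + Bf) * (2 * ρ') := mul_le_mul_of_nonneg_left ha2 hn
      _ = 2 * (n + Bf) / (1 - δ) * ρ := by rw [hρ']; field_simp
  · -- (S-i)₀ the core map for the classifier (comb letters are unit letters)
    intro V x hx _ hux
    rw [hexp, hU]
    have h1 : Pu.sup' hPu (fun p => ‖wordExp (L V x p) - 1‖) < θ := by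
      have h := hU V x 1
      rw [one_smul] at h
      rw [h] at hux
      simpa only [scale_one] using hux
    exact coreMap_sup hPu (L V x) hc0 hc1 (fun p hp => (hLsize V x hx p (hPubox p hp)).trans h8S1) hθ
      (fun p hp => (interpConst_mono (normSum_nonneg _) (hLsize V x hx p (hPubox p hp))).trans hSM) hdepth h1
  · -- (S-ii)₀ the co-test rides free (hmono); the Wilson weight loses at most `e^{Bf a}`
    intro V x hx hR0 _
    rw [hexp]
    have hmem1 : fixTo (combBonds lo hi) 1 (updateFinset V Λ (expFibreChart Λ 1 e x)) ∈ boxTest lo hi σ := by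
      by_contra hnot
      exact hR0 (by unfold giF; rw [indicator_of_notMem hnot, zero_mul])
    have hmem2 := hmono V x hx hmem1
    unfold giF
    rw [indicator_of_mem hmem1, indicator_of_mem hmem2]
    simp only [Pi.one_apply, one_mul]
    rw [fixTo_updateFinset_of_disjoint hΛcomb, fixTo_updateFinset_of_disjoint hΛcomb]
    have h1 : expFibreChart Λ 1 e x = expFibreChart Λ 1 e ((1 : ℝ) • x) := by rw [one_smul]
    rw [h1, wilsonSum_chart_smul, wilsonSum_chart_smul]
    obtain hdata := fun p => plaqWord_data Λ e hS.le (fixTo (combBonds lo hi) 1 V) hx p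
    have hdiff := wilsonAction_contract_sub_le (matrixTrace (n := Fin 2)) hNtr Pw
      (fun p => plaqWord Λ e (fixTo (combBonds lo hi) 1 V) x p)
      (fun p _ => (hdata p).1) (sb := fun _ => 8 * S) (db := fun _ => 8) (fun p _ => (hdata p).2.1)
      (fun p _ => h8S1) (fun p _ => (hdata p).2.2) hβ hc0.le hc1
    rw [← hBf] at hdiff
    have hle : β * ∑ p ∈ Pw, (1 - (matrixTrace (n := Fin 2)).τ
          (wordEval (1 - ρ') (plaqWord Λ e (fixTo (combBonds lo hi) 1 V) x p)) / (matrixTrace (n := Fin 2)).N) -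
        β * ∑ p ∈ Pw, (1 - (matrixTrace (n := Fin 2)).τ
          (wordEval 1 (plaqWord Λ e (fixTo (combBonds lo hi) 1 V) x p)) / (matrixTrace (n := Fin 2)).N) ≤
        Bf * a :=
      hdiff.trans (by nlinarith)
    rw [← ENNReal.ofReal_mul (Real.exp_pos _).le, ← Real.exp_add]
    exact ENNReal.ofReal_le_ofReal (Real.exp_le_exp.2 (by linarith))

end Main

end Summit.QuantumFields.BalabanUV.T4Continuum.ShellMeasureWilsonGaugeInvariant
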